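import Mathlib
import HarnessLib
import HarnessLib.Audit
import Summits.NavierStokesRegularity.Statement
import Literature.Analysis.FluidPDE.ClassicalSolution
import Literature.Analysis.FluidPDE.LerayHopf
import Literature.Analysis.FluidPDE.NSWave0
import Literature.Analysis.FluidPDE.VectorCalculus
import Literature.Analysis.FluidPDE.AxisymmetricEuler
import Summits.NavierStokesRegularity.NavierStokesRegularity.Theorems.AdiabaticEddyClayUniqueness
import HarnessLib.Audit.Status.Attr

/-!
Route: SwirlStarvation

DORMANT since 2026-09-01T12:17:40Z (reconciler: no traction for 5 d (last activity statement-checked at 2026-08-27T11:27:57Z); parked, not closed — `ledger route dormant route-NavierStokesRegularity-SwirlStarvation --off` to reactivate) — unstaffed, not closed; items shared with open routes are served there. `ledger route dormant <id> --off` reactivates.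

# Route SwirlStarvation — where Hou's logarithms must sit — the creep window of an axisymmetric
singularity (starvation floor log^1/3, marginal ceiling log^1/2) and the blow-up class between them

TWO-SIDED scenario route on the axisymmetric-with-swirl class, realising idea card
swirl-starvation-creep-window (spine, sole card); summit-bearing spine NEGATIVE (the deciding
theorem concludes ¬NavierStokesRegularity, opened with --refutation). Write the velocity excess of a
putative axisymmetric singularity at time T as c_u(t)² := ‖u(t)‖∞²(T−t)/ν (Leray power × excess;
Type I = c_u bounded, excluded in this class by KNSS2009/SereginSverak2009). The card's log audit —
(S) parabolic smoothing ν‖ω‖∞ ≤ C_S·(window sup ‖u‖)², (F) front floor δ ≥ cν/‖u‖∞ (in-tree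
guberovic2010_analyticity_radius_holds), (Θ) swirl Type-I-sized off the axis by the Γ maximum
principle, (H) the only vorticity source is ∂_z(u_θ/r)² in the equation of η = ω_θ/r — confines the
creep exponent p (c_u ~ |log(T−t)|^p) of ANY axisymmetric blow-up to a window: p ≥ 1/3 (STARVATION
FLOOR: slower creep starves η and η bounded is regular) and, if the only template anyone has
(one-loop modulation / Hou's Burgers-thin Γ-front) is right, p ≤ 1/2 (MARGINAL CREEP). It suffices
to show X = MarginalCreepBlowup ∧ BlowupClayUniqueness: (MarginalCreepBlowup, crux #4, the
constructive statement the audit singles out) for some ν > 0 a Leray–Hopf classical solution from a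
rapidly decaying datum, axisymmetric on [0,T), is maximal with finite lifespan T and creeps at most
marginally, ‖u(t,x)‖²(T−t) ≤ Cν(1 + log(T/(T−t))) on some [t₁,T) — the rate class Hou's own
vorticity fit |log(T−t)|/(T−t) supports via (S), and NOT the vorticity-Type-I certificate class of
route CertifiedBlowup (#3 there, (T−t)‖ω‖∞ ≤ C, contradicts that fit); (BlowupClayUniqueness,
support, verbatim stmt-NavierStokesRegularity-0153, shared with
Blowup/CertifiedBlowup/SwirlThreshold/DimensionLadder — and settled in substance on 2026-08-15: its
negation stmt-0154 is REFUTED in tree by Theorems/BlowupBlowupClayNonuniquenessRefutation.lean from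
Literature.Analysis.FluidPDE.tao_unconditional_uniqueness_velocity_holds, so the spine alone
decides). The regularity side is typed as two deciders of the same node: StarvationFloor (crux #2:
every axisymmetric blow-up has limsup c_u³/log(T/(T−t)) > 0 — its NEGATION proves the spine, support
StarvationFailureBlowup) and NoMarginalCreep (crux #3: limsup c_u²/log = ∞ — the spine's typed
negation, support CreepDichotomy; proved, it closes the route refuted and kills the κ > 0 / Γ-front
template in the axisymmetric class).
Lean: `(∃ ν : ℝ, 0 < ν ∧ ∃ T : ℝ, 0 < T ∧ ∃ (u : ℝ → EuclideanSpace ℝ (Fin 3) → EuclideanSpace ℝ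
(Fin 3)) (p : ℝ → EuclideanSpace ℝ (Fin 3) → ℝ),
Literature.Analysis.FluidPDE.IsMaximalSmoothSolution ν 0 u p T ∧
Literature.Analysis.FluidPDE.IsLerayHopfOn T ν 0 (u 0) u ∧
Literature.Analysis.FluidPDE.HasRapidSpatialDecay (u 0) ∧ (∀ t ∈ Set.Ico 0 T,
Literature.Analysis.FluidPDE.IsAxisymmetric (u t)) ∧ ∃ C : ℝ, ∃ t₁ ∈ Set.Ico 0 T, ∀ t ∈ Set.Ico t₁
T, ∀ x : EuclideanSpace ℝ (Fin 3), ‖u t x‖ ^ 2 * (T - t) ≤ C * ν * (1 + Real.log (T / (T - t)))) ∧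
(∀ ν : ℝ, 0 < ν → ∀ (u₀ : EuclideanSpace ℝ (Fin 3) → EuclideanSpace ℝ (Fin 3)),
Literature.Analysis.FluidPDE.HasRapidSpatialDecay u₀ → ∀ (u v : ℝ → EuclideanSpace ℝ (Fin 3) →
EuclideanSpace ℝ (Fin 3)) (p q : ℝ → EuclideanSpace ℝ (Fin 3) → ℝ) (T : ℝ), 0 < T →
Literature.Analysis.FluidPDE.IsSmoothOnHalfSpace u →
Literature.Analysis.FluidPDE.IsSmoothOnHalfSpace p →
Literature.Analysis.FluidPDE.IsNavierStokesSolution ν 0 u₀ u p →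
Literature.Analysis.FluidPDE.HasBoundedEnergy u →
Literature.Analysis.FluidPDE.IsClassicalNSSolutionOn (Set.Ico 0 T) ν 0 v q →
Literature.Analysis.FluidPDE.IsLerayHopfOn T ν 0 u₀ v → v 0 = u₀ → ∀ t ∈ Set.Ico 0 T, u t = v t)`

## Assembly
Pure logic, self-contained (rev 1, route-repair: no Theorems import): from the MarginalCreepBlowup
witness (ν,T,u,p) forget the axisymmetry and rate conjuncts (this is X5a, finite-time blow-up of a
maximal Leray–Hopf classical solution from a rapidly decaying datum); apply (A) =
NavierStokesRegularity to the datum u 0 (smooth and divergence-free as a slice of the classical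
solution, rapidly decaying by hypothesis) to get a global class-(A) solution (u′,p′);
BlowupClayUniqueness (X5b) gives u′ = u on [0,T); the Fefferman wave-0 predicate plus joint
smoothness is field-for-field a classical solution on Ici 0 (two anonymous constructors — the
content of Literature.Analysis.FluidPDE.isNavierStokesSolution_and_smooth_iff, inlined so that
NSLerayHopf.lean and its unproved named facts stay out of the import cone), and its restriction to
[0,T+1) extends u past T, contradicting maximality — the argument of Literature.NS.blowup_assembly
(Theorems/BlowupAssembly.lean, stmt-NavierStokesRegularity-0151) re-run in place. Deciding theorem
(--refutation): `theorem closes (hB : MarginalCreepBlowup) (hU : BlowupClayUniqueness) : ¬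
NavierStokesRegularity` (11 tactic lines over ClassicalSolution/LerayHopf/NSWave0 only; axioms
propext, Classical.choice, Quot.sound). The other items are the typed two-sided analysis of the
spine (StarvationFloor, NoMarginalCreep with their logic supports) and the two provable-now analytic
inputs of the audit (EtaBoundedRegular, SmoothingExcess); they are carried by the route, not
consumed by `closes`.

Rationale: WHY THIS LINE. Mechanism (card swirl-starvation-creep-window): in the axisymmetric class the swirl
maximum principle (in-tree Literature.Analysis.FluidPDE.swirl_transport_holds; KNSS2009 (1.8),
ChaeLee2002, LeiZhang2011) is the one critical a-priori bound 3-D Navier–Stokes has, and here it is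
spent not on a modulus of Γ at the axis (LeiZhang2017, Wei2016, Pan 2016 arXiv:1410.6260, Seregin
arXiv:2109.09344, Chen–Tsai–Zhang arXiv:2201.01766) but on STARVING the singularity's only vorticity
source: η = ω_θ/r obeys D̃_t η = ν(Δ + (2/r)∂_r)η + ∂_z((u_θ/r)²) (HouLi2008 §2; in-tree
angVortQuot/angVelQuot, AxisymHouLiVariables), so ‖η(t)‖∞ ≤ ‖η(t₀)‖∞ + ∫‖∂_z(u_θ/r)²‖∞, while (S)
ties every vorticity log to a velocity log of at least half its power, (F) forbids fronts thinner
than Burgers thickness ν/‖u‖∞ and (Θ) makes the swirl Type-I-sized at r ≳ √(νRe_Γ(T−t)); closing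
these four facts over the creeping clock gives the floor p ≥ 1/3, and η bounded is regular (support
EtaBoundedRegular: η bounded ⇒ u_r/r bounded by the in-tree elliptic identity
laplacian_radVelQuot_add ⇒ u_θ/r grows at most exponentially ⇒ u_θ bounded ⇒
Chae–Lee/Neustupa–Pokorný continuation). Sources: Hou2022PotentiallySingularNS §3.4.1 (read: ‖u₁‖∞,
‖ψ_{1z}‖∞ ~ (T−t)⁻¹, ‖ω‖∞ ~ |log(T−t)|/(T−t), ‖ω₁‖∞ ~ (T−t)^{-3/2}, ‖u‖∞ ~ (T−t)^{-1/2}, Z ~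
(T−t)^{1/2}, ν = 5·10⁻³, 1536²; 'the potential blow-up rate is most likely not exactly 1/2'),
Hou2026 (n = 3.188 or λ(t) = (1+ε|log(T−t)|)^{-1/2}; 'sharp shock-like travelling wave for Γ'),
KNSS2009 Thm 5.3 and SereginSverak2009 Thm 1.1 (Type I excluded, so the logs are compulsory),
GigaInuiMatsui1999 / KNSS2009 Prop 4.1 for (S), GrujicKukavica1998 /
guberovic2010_analyticity_radius for (F), GallayMaekawa2010 for the stability of Burgers-thin
structures. Imported areas: parabolic smoothing and analyticity-radius technology (mild L^∞ theory),
maximum principles with source for drift–diffusion in Hou–Li variables, one-loop modulation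
heuristics (the p = 1/2 value of the companion card marginal-reynolds-creep-kappa) — a physical
'budget' argument made into typed rate statements; no spectral/probabilistic reformulation (none
sees the swirl structure). What it does that prior routes do not: CertifiedBlowup types the
constructive target by the vorticity-rate certificate class (T−t)‖ω‖∞ ≤ C, which Hou's own vorticity
fit violates; SwirlThreshold decomposes AxisymBlowup by the ORDER PARAMETER sup|Γ|/ν;
DimensionLadder by continuation in n; VorticityPace asks ν‖ω‖∞/‖u‖∞² ↛ 0 for general data under (L).
This route decomposes the same shared node by CREEP EXPONENT with deciders on both sides
(¬StarvationFloor ⇒ spine; NoMarginalCreep ⇔ ¬spine), and its floor crux is the first power-of-log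
(not log log) Type-II exclusion proposed for the axisymmetric class — print stops at (ln
ln(1/(T−t)))^{1/48−} in Ḃ^{-1}_{∞,∞} (arXiv:2201.01766 Thm 1.4), (ln ln)^α on weighted L^p (Palasek
arXiv:2101.08586), (ln|ln r|)^{0.028} on r|b| (arXiv:1410.6260 Thm 1.1) and (ln ln)^{1/224} on
scaled energies (arXiv:2109.09344 Thm 1.3), all by Harnack/De Giorgi technology that the
Seregin–Silvestre–Šverák–Zlatoš drift counterexample caps at ln ln (arXiv:1410.6260 §1).

RANKED CRUXES. #0 Thesis (target) — X = MarginalCreepBlowup ∧ BlowupClayUniqueness (a marginally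
creeping axisymmetric blow-up exists, and Fefferman class-(A) solutions are unique against the
Leray–Hopf classical solution); with the deciding theorem this is ¬NavierStokesRegularity. (why it
might fail: axisymmetric data may simply be globally regular (conjecture leaf
AxisymmetricSwirlRegularity), or every axisymmetric blow-up may creep faster than √log
(NoMarginalCreep); Hou's constant-ν fits are declared qualitative by the paper itself.)
[Hou2022PotentiallySingularNS, Hou2026, KNSS2009, SereginSverak2009, Fefferman2000,
arXiv:2107.06509]
#2 StarvationFloor (crux) — STARVATION FLOOR (card K1, 'slow creep is impossible'): for every ν > 0
and every maximal Leray–Hopf classical solution (u,p) on ℝ³×[0,T) from a rapidly decaying datum,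
axisymmetric on [0,T), there is c > 0 such that for every t₁ < T some t ∈ [t₁,T) and point x satisfy
c·log(T/(T−t)) ≤ (‖u(t,x)‖√((T−t)/ν))³ — i.e. limsup_{t↑T} c_u(t)/log(T/(T−t))^{1/3} > 0: the
velocity excess of an axisymmetric singularity cannot creep slower than the cube root of the
logarithm (Type I, c_u bounded, is the case print excludes; exponent 1/3 is the card's single-core
starvation threshold, target 1/2). [difficulty: XL] (why it might fail: print reaches only (ln ln
1/(T−t))^{1/48−} (arXiv:2201.01766 Thm 1.4; Palasek arXiv:2101.08586) and Harnack methods provably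
stall at ln ln; |ln|^{1/3} rests on the η-budget, which leaks if u_θ/r concentrates at r ≪
√(νRe_Γ(T−t)) where Γ does not control it.) [ChenTsaiZhang2022, Palasek2021, Pan2014, Seregin2021,
arXiv:2201.01766, arXiv:2101.08586, KNSS2009, SereginSverak2009, LeiZhang2017, HouLi2008,
Hou2022PotentiallySingularNS]
#3 NoMarginalCreep (crux) — NO MARGINAL CREEP (card K2, instability branch, typed as a decider): in
the same class, for every C and every t₁ < T some t ∈ [t₁,T) and x satisfy Cν(1 + log(T/(T−t))) <
‖u(t,x)‖²(T−t) — i.e. limsup_{t↑T} c_u(t)²/log(T/(T−t)) = ∞: an axisymmetric singularity must creep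
strictly faster than the one-loop / quasi-steady Γ-front rate p = 1/2 (the self-sharpening swirl
front of Burgers thickness ν/‖u‖∞ that the audit requires at p ≤ 1/2 cannot be sustained over
infinitely many turnover times at front Reynolds number c_u² → ∞). Equivalent to
¬MarginalCreepBlowup (support CreepDichotomy) and implies StarvationFloor (support
NoMarginalCreepFloor); proved, it closes this route refuted and removes the κ > 0 template of card
marginal-reynolds-creep-kappa from the axisymmetric class. [difficulty: XL] (why it might fail:
viscous fronts at exactly Burgers thickness have front-Reynolds number O(1) on their own scale — the
regime where Burgers vortices/shear layers ARE stable for all circulation Reynolds numbers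
(GallayMaekawa2010) — and Hou's travelling Γ-front persists numerically (Hou2026 §4).)
[GallayMaekawa2010, Hou2026, Hou2022PotentiallySingularNS, arXiv:2405.10916, KNSS2009]
#4 MarginalCreepBlowup (crux) — MARGINAL-CREEP BLOW-UP (the constructive spine; card negative branch
'K2 persistence ∧ κ > 0 template'): for some ν > 0 there are T ∈ (0,∞) and a classical solution
(u,p) of unforced Navier–Stokes on ℝ³×[0,T), Leray–Hopf from its rapidly decaying datum,
axisymmetric at every t ∈ [0,T), admitting no classical extension past T, whose velocity excess
creeps at most marginally: for some C and t₁, ‖u(t,x)‖²(T−t) ≤ Cν(1 + log(T/(T−t))) for all t ∈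
[t₁,T), x. Strictly stronger than the shared AxisymBlowup (stmt-NavierStokesRegularity-0727: drop
the rate); by AxisymmetricTypeIExclusion (in tree, proved) every witness has c_u unbounded, so the
class is the first super-Type-I shell c_u ≍ √log — the audited reading of Hou's run (q_ω = 1 ⇒ p ≥
1/2 by (S); Z ~ √(T−t); Burgers-thin Γ-front), to be reached by a log-corrected dynamic-rescaling
construction/certificate. [difficulty: open-problem] (why it might fail: axisymmetric NS may be
regular (AxisymmetricSwirlRegularity); no constant-ν construction exists (Hou2026 needs n = 3.188 or
a solution-dependent viscosity), and a √log-corrected profile has no exact similarity ODE to certify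
against (LeraySelfSimilarBlowupExclusion forces the correction).) [Hou2022PotentiallySingularNS,
Hou2026, arXiv:2405.10916, ChenHou2022, KNSS2009, NecasRuzickaSverak1996, Tsai1998]
#9 BlowupClayUniqueness (support) — Clay-class uniqueness X5b (verbatim
stmt-NavierStokesRegularity-0153, shared with routes Blowup / CertifiedBlowup / SwirlThreshold /
DimensionLadder): a jointly smooth bounded-energy solution of (A) from a rapidly decaying datum
coincides on [0,T) with the Leray–Hopf classical solution from the same datum. Settled in substance:
¬X5b (stmt-0154) is refuted in tree (Theorems/BlowupBlowupClayNonuniquenessRefutation.lean, from Tao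
2013 arXiv:1108.1165 Cor. 11.4 = in-tree tao_unconditional_uniqueness_velocity_holds); the positive
proof is attached as evidence on 0153 and is a one-session prover job. [difficulty: provable-now]
[Fefferman2000, LemarieRieusset2016, arXiv:1108.1165]
#9 CreepDichotomy (support) — NoMarginalCreep ↔ ¬MarginalCreepBlowup — push the negation through ∃/∀
(PROVED in the planner's Sketch.lean, creepDichotomy_holds), so that a proof of either crux closes
the other as refuted in one line. [difficulty: provable-now] [KNSS2009]
#9 StarvationFailureBlowup (support) — ¬StarvationFloor → MarginalCreepBlowup — the floor crux is
informative both ways: its failure exhibits an axisymmetric blow-up with c_u³ < log(T/(T−t))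
eventually, hence c_u² ≤ 1 + log (y ≥ 0, y³ < L ⇒ y² ≤ 1 + L), i.e. the spine with C = 1 (PROVED in
Sketch.lean, starvationFailureBlowup_holds). [difficulty: provable-now] [KNSS2009]
#9 NoMarginalCreepFloor (support) — NoMarginalCreep → StarvationFloor — the nesting of the two
regularity-side cruxes (c_u² > 1 + log ⇒ c_u > 1 ⇒ c_u³ > log; take c = 1), so that the creep window
[1/3, 1/2] is exactly StarvationFloor ∧ ¬NoMarginalCreep (PROVED in Sketch.lean). [difficulty:
provable-now] [KNSS2009]
#9 EtaBoundedRegular (support) — ETA-BOUNDED CONTINUATION (card P1 criterion; the lower half of the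
foreseen split of StarvationFloor): a Leray–Hopf classical solution on ℝ³×[0,T) from a rapidly
decaying datum, axisymmetric on [0,T), with |r·ω_θ| = |swirl(curl u)| ≤ K r² on [0,T)×ℝ³ (i.e. η =
ω_θ/r = angVortQuot bounded) extends classically past T. Route: η ∈ L^∞ (+ energy) ⇒ u_r/r = ∂_z
Δ₅⁻¹ η bounded (in-tree elliptic identity IsAxisymmetric.laplacian_radVelQuot_add; LeiZhang2017
Lemma 2.1) ⇒ u_θ/r obeys a linear drift–diffusion equation with bounded potential −2u_r/r, so
sup|u_θ/r| ≤ sup|u₀,θ/r|·exp(2∫‖u_r/r‖∞) ⇒ u_θ bounded near the axis (and |u_θ| ≤ ‖Γ₀‖∞/r away) ⇒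
continuation by the u_θ ∈ L^∞_tL^∞_x criterion (ChaeLee2002; Neustupa–Pokorný; ChenFangZhang2017)
and (∞,∞)-Prodi–Serrin. [difficulty: L] [ChaeLee2002, ChenFangZhang2017, LeiZhang2017, HouLi2008,
KNSS2009]
#9 SmoothingExcess (support) — SMOOTHING EXCESS BOUND (card fact (S), c_ω ≤ C_S c_u²; general data,
no symmetry): there is an absolute C_S such that for every Leray–Hopf classical solution on [0,T)
from a rapidly decaying datum, every M and times 0 ≤ t₀ < t < T with ν ≤ M²(t − t₀) and ‖u‖ ≤ M on
[t₀,t]×ℝ³, one has ν‖curl u(t,x)‖ ≤ C_S M² for all x — the k = 1 case of the L^∞ mild smoothing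
estimate (GigaInuiMatsui1999; KNSS2009 Prop 4.1/(4.6), in-tree KNSS2009_prop41_mild) applied from t
− ν/M², plus identification of the classical Leray–Hopf solution with the bounded mild one.
[difficulty: M] [GigaInuiMatsui1999, KNSS2009, LemarieRieusset2016]

TWO-LAYER PLAN. Foreseen glued splits (k ≤ 3, depth 1; nothing filed now). StarvationFloor ⇐
SlowCreepBoundsEta → EtaBoundedRegular → StarvationFloor, where SlowCreepBoundsEta (the starvation
inequality proper; elaborates in Sketch.lean) reads: classical Leray–Hopf axisymmetric (u,p) on
[0,T) with ∀ c > 0 eventually (‖u‖√((T−t)/ν))³ < c·log(T/(T−t)) ⇒ ∃ K, |swirl(curl u(t))(x)| ≤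
K·cylRadius(x)² on [0,T) — proof plan: Duhamel for η with source ∂_z(u_θ/r)², (Θ) |u_θ/r| ≤
νRe_Γ/r², (F) |∂_z(u_θ/r)| ≲ ‖u‖∞/ν·|u_θ/r| at the front floor, (S) for the window, CKN to confine
everything to r ≲ √(ν(T−t)), and the integrability of (T−t)^{-1}·log^{-(1+ε)} that exponent 1/3
buys; glue: maximal = no extension. NoMarginalCreep ⇐ GammaFrontLinearInstability (the linearised
axisymmetric NS operator about a quasi-steady Burgers-thin Γ-front in similarity variables has an
unstable eigenvalue growing with the front Reynolds number — needs a definition item first) →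
ModulationShedding (instability on the creeping clock forces c_u²/log → ∞ or collapse of the front)
→ NoMarginalCreep. MarginalCreepBlowup ⇐ GammaFrontProfile (an approximate travelling-front profile
with Burgers thickness and the audited exponents, certified) → LogCorrectedStability (nonlinear
stability in dynamic-rescaling variables with the λ(t) = (1+ε|log(T−t)|)^{-1/2} correction of
Hou2026 at constant ν) → MarginalCreepBlowup, sharing the certificate layer of route CertifiedBlowup
(BlowupProfileData / BlowupProfileConditions) with the rate class changed.

KILL CRITERIA. (a) NoMarginalCreep proved (or AxisymmetricSwirlRegularity proved by any route, which
gives it through 0153-free logic: no axisymmetric maximal solution exists) ⇒ MarginalCreepBlowup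
refuted via CreepDichotomy ⇒ `close --reason refuted:MarginalCreepBlowup`;
StarvationFloor/NoMarginalCreep survive as theorems of independent value (first power-log
axisymmetric Type-II floor) and the κ > 0 template dies in the axisymmetric class (inform cards
marginal-reynolds-creep-kappa, viscosity-selected-singularity). (b) StarvationFloor refuted ⇒ the
spine is PROVED (StarvationFailureBlowup) ⇒ with BlowupClayUniqueness the summit is settled
negatively (and CertifiedBlowup's AxisymBlowup closes too). (c) BlowupClayUniqueness can no longer
fail (its negation stmt-0154 is refuted in tree, 2026-08-15), so the spine MarginalCreepBlowup alone
decides ¬NavierStokesRegularity. (d) NoBlowup (stmt-0054) or NoTypeII-type general statements proved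
⇒ moot, close superseded. (e) A refit/rerun of Hou's scenario showing c_u²/log(T/(T−t)) → ∞
unmistakably (p > 1/2) kills the spine's rate class: close refuted:MarginalCreepBlowup-by-evidence
is NOT available (evidence is not a theorem) — pivot instead: drop the rate conjunct (the route then
merges into CertifiedBlowup/DimensionLadder, close superseded). (f) A refuter deriving
EtaBoundedRegular or SmoothingExcess from print changes nothing (they are support).

NOT DECOMPOSED YET. The starvation inequality itself (SlowCreepBoundsEta) and its constants; the
front floor (F) and the swirl bound (Θ) as items — both are in-tree theorems
(guberovic2010_analyticity_radius_holds, swirl_transport_holds + maximum principle) to be invoked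
inside proofs, not filed; the card's K3 window-to-pointwise lemma — unnecessary for the limsup forms
chosen here (an eventual o(log^{1/3}) bound controls the backward window too), needed only for
liminf versions, which are not filed; the similarity-variable linearisation about a Γ-front needed
to TYPE the mechanism behind NoMarginalCreep (definition item at split time); everything numerical
(the card's P2 log audit of Hou's run: fit c_u, c_ω, Z/√(ν(T−t)), front thickness·‖u‖∞/ν and the
location/orientation of max|ω| against |log(T−t)|) — refuter/kit work, named in Cheapest falsifier.

CHEAPEST FALSIFIER. (i) CONSISTENCY AUDIT OF THE PRINTED FITS (done by reading
Hou2022PotentiallySingularNS §3.4.1): ‖ω‖∞ ~ |log(T−t)|/(T−t) together with ‖u‖∞ ~ (T−t)^{-1/2}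
violates the theorem-level inequality (S) ν‖ω‖∞ ≤ C_S(sup‖u‖)² as t ↑ T, so at least one fit is
pre-asymptotic — the paper concedes the velocity rate 'is most likely not exactly 1/2'; the route
bets the hidden factor is √|log| in ‖u‖∞ (p = 1/2). A refit of the published ‖u‖∞⁻² vs t data
against (T−t)/(1+ε|log(T−t)|) that came out WORSE than the pure power law would cheapen the spine; a
rerun (kit, axisymmetric solver, ν = 5·10⁻³) showing c_u²/|log| growing without bound kills its rate
class. (ii) LOOKUP (run 2026-08-15, arXiv/S2 remote + galaxy): a printed axisymmetric criterion at a
power-log rate, |u| ≤ C|ln(T−t)|^a(T−t)^{-1/2} ⇒ regular for some a > 0, would make StarvationFloor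
'known up to the exponent' — none found; print stops at (ln ln)^{1/48−} (arXiv:2201.01766 Thm 1.4).
(iii) MODEL TEST: exhibit an axisymmetric blow-up ansatz consistent with (S),(F),(Θ),(H) whose
η-source is fed by an axis-hugging u_θ/r structure at r ≪ √(νRe_Γ(T−t)) with p < 1/3 — kills the
proof plan of StarvationFloor (not the statement).

NUMBERS. Hou2022PotentiallySingularNS §3.4.1 (1536², ν = 5·10⁻³, vorticity amplification 10⁷ over
the fitting window): ‖u₁‖∞, ‖ψ_{1z}‖∞ ~ (T−t)⁻¹; ‖ω‖∞ ~ |log(T−t)|/(T−t); ‖ω₁‖∞ = ‖ω_θ/r‖∞ ~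
(T−t)^{-3/2}; ‖u‖∞ ~ (T−t)^{-1/2}; Z(t) ~ (T−t)^{1/2}. Hou2026: n = 3.188 (constant ν) or λ(t) =
(1+ε|log(T−t)|)^{-1/2} (two-viscosity model). Printed axisymmetric supercritical criteria: r|b| ≤
N(ln ln(100/r))^{0.028} (arXiv:1410.6260 Thm 1.1); scaled energies ≤ c*(ln ln)^{1/224}
(arXiv:2109.09344 Thm 1.3); A(z₀,R)(ln ln(100/R))^{-β} ≤ K, β < 1/8, and blow-up forces limsup
‖b‖_{Ḃ⁻¹_{∞,∞}}/(ln ln(100/(−t)))^{1/48−} = ∞ (arXiv:2201.01766 Prop 1.2, Thm 1.4). Type I (c_u ≤ C,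
any C) excluded (KNSS2009 Thm 5.3, SereginSverak2009 Thm 1.1; in-tree
AxisymmetricTypeIExclusion_holds); Leray floor c_u ≥ c₀ > 0 (Leray1934). Route exponents: floor 1/3,
ceiling 1/2. Items at open: 11 (3 cruxes, 1 target, 1 assembly, 6 support).

DEFINITION REQUESTS. None required at open: every statement is inlined over
Literature.Analysis.FluidPDE.{IsMaximalSmoothSolution, IsClassicalNSSolutionOn, IsLerayHopfOn,
HasRapidSpatialDecay, HasSmoothExtensionPast, IsAxisymmetric, swirl, curl, cylRadius} (all `lean
search --decl`-verified; Sketch.lean rc 0); provers of EtaBoundedRegular / the StarvationFloor split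
have angVortQuot, angVelQuot, radVelQuot and the elliptic identity in
Literature.Analysis.FluidPDE.AxisymHouLiVariables. A definition `GammaFrontLinearisation`
(linearised axisymmetric NS about a quasi-steady swirl front in similarity variables) will be
requested when NoMarginalCreep is split, not before.

Novelty: Searches (2026-08-15): `lit frontier NavierStokesRegularity --since 2022` (30 rows; relevant:
Hou2026 doi:10.1007/s10208-026-09748-8, arXiv:2602.09951, arXiv:2604.13338 — none a log audit); `lit
search --source arxiv "slightly supercritical axisymmetric Navier-Stokes"` (3: arXiv:2109.09344,
arXiv:2201.00153, arXiv:2201.01766 — all (ln ln)^α criteria, read 2109.09344 Thm 1.3 and 2201.01766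
Prop 1.2/Thms 1.3–1.5 in full); `lit search --source s2 "regularity criterion axisymmetric
Navier-Stokes omega_theta over r bounded"` (7, none on point; Palasek ARMA 2021 arXiv:2101.08586
surfaced); `lit search --source zbmath "axially symmetric Navier-Stokes blow-up rate logarithmic"`
(0); `lit search` local/hybrid: searchd unavailable (rc 75) all session; `lit galaxy search "blow-up
rate of the axisymmetric Navier-Stokes" --star all` (4: Seregin lecture notes, Giga arXiv:1310.6471,
Bjorland–Vasseur log-LPS — not axisymmetric-rate results); `lit galaxy search "axisymmetric
Navier-Stokes equations type II" --star all` (0); `"Type II blowups of axisymmetric solutions"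
--star all` (0); `"logarithmic correction to the self-similar blow-up rate" --star all` (0); `lit
galaxy search --star pdf --mode bm25 "axisymmetric Navier-Stokes regularity under a slightly
supercritical logarithmic bound … |u| <= C|log(T-t)|^a/sqrt(T-t)"` (12, all
engineering/astrophysics, none relevant); reads: arXiv:2107.06509 §3.4.1 (fits verified verbatim),
arXiv:1410.6260 Thm 1.1 + §1, arXiv:2109.09344 Thm 1.3, arXiv:2201  [refs: 10.1007/s10208-026-09748-8, 2602.09951, 2604.13338, 2109.09344, 2201.00153, 2201.01766, 2101.08586, 1310.6471, 2107.06509, 1410.6260, doi:10.1007/s10208-026-09748-8, Hou2026, ChenTsaiZhang2022, Palasek2021, Pan2014, Seregin2021]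

Barriers (technique_class: axisymmetric-log-audit, maximum-principle-budget): - technique_class: axisymmetric-log-audit, maximum-principle-budget
- Literature.Barriers.NavierStokesRegularity.AxisymmetricTypeIExclusion: the spine's class {c_u² ≤
C(1+log)} contains Type-I members only vacuously — the barrier (proved in tree) empties exactly
those, so every witness creeps (c_u unbounded, ≍ √log); the regularity-side cruxes START where the
barrier ends and quantify it (floor |ln|^{1/3}); conceded: the barrier's Liouville mechanism gives
no rate, so nothing of its proof transfers.
- Literature.Barriers.NavierStokesRegularity.LeraySelfSimilarBlowupExclusion: the constructive
target is explicitly NOT exactly self-similar (log-creeping excess, Hou's 'nearly self-similar'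
profile with λ(t)-correction); conceded that this is also why no similarity ODE certifies it
(why-might-fail of MarginalCreepBlowup).
- Literature.Barriers.NavierStokesRegularity.CriticalNormBlowupNecessity: consistent — a marginally
creeping axisymmetric blow-up has ‖u(t)‖_{L³} → ∞ (it is Type II in velocity), and Tao's triple-log
L³ rate is far below the √log excess posited; nothing here keeps a critical norm bounded.
- Literature.Barriers.NavierStokesRegularity.EnergySupercriticality: the regularity-side cruxes use
no energy-class coercivity: their inputs are the critical swirl maximum principle, parabolic
smoothing at the solution's own scale (S), the analyticity floor (F) and the η-source identity (H) —
structure specific to axisymmetric true NS; conceded that the η-budget can leak throug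

History (route lifecycle, newest last):
- 2026-08-22T15:55:53Z · DORMANT — reconciler: no traction for 5.5 d (last activity item-evidence-added at 2026-08-17T04:15:07Z); parked, not closed — `ledger route dormant route-NavierStokesRegu (operator:999:656230)
- 2026-08-26T16:15:33Z · REACTIVATED — reconciler: reactivated — activity statement-closed at 2026-08-26T15:38:06Z after parking at 2026-08-22T15:55:53Z (operator:999:442332)
- 2026-09-01T12:17:40Z · DORMANT — reconciler: no traction for 5 d (last activity statement-checked at 2026-08-27T11:27:57Z); parked, not closed — `ledger route dormant route-NavierStokesRegulari (operator:999:3801225)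

sub-problem: NavierStokesRegularity · status: dormant · opened planner-plancard-NavierStokesRegularity-Navie-b2cc5933-0 2026-08-15T20:08:09Z · rev 2 · ledger route-NavierStokesRegularity-SwirlStarvation
GENERATED by the gate from the ledger (D-0016/17). Provers cite these decls: `theorem foo : Summit.NavierStokesRegularity.NavierStokesRegularity.Theses.SwirlStarvation.<Decl> := …` in Summits/NavierStokesRegularity/NavierStokesRegularity/Theorems/<Name>.lean.
-/

namespace Summit.NavierStokesRegularity.NavierStokesRegularity.Theses.SwirlStarvation

open scoped BigOperators Topology Manifold Classical MeasureTheory ProbabilityTheory Matrix InnerProductSpace ComplexConjugate ContinuousMap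
open Filter Set Function TopologicalSpace MeasureTheory

attribute [summit_statement] _root_.NavierStokesRegularity

open Literature.NS

/-- item stmt-NavierStokesRegularity-13880 · target · rank 0 · open · by planner
why it might fail: axisymmetric data may simply be globally regular (conjecture leaf AxisymmetricSwirlRegularity), or every axisymmetric blow-up may creep faster than √log (NoMarginalCreep); Hou's constant-ν fits are declared qualitative by the paper itself.
sources: Hou2022PotentiallySingularNS, Hou2026, KNSS2009, SereginSverak2009, Fefferman2000, arXiv:2107.06509
[target] X = MarginalCreepBlowup ∧ BlowupClayUniqueness (a marginally creeping axisymmetric blow-up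
exists, and Fefferman class-(A) solutions are unique against the Leray–Hopf classical solution);
with the deciding theorem this is ¬NavierStokesRegularity. -/
@[route_item "route-NavierStokesRegularity-SwirlStarvation"]
def Thesis : Prop :=
  (∃ ν : ℝ, 0 < ν ∧ ∃ T : ℝ, 0 < T ∧ ∃ (u : ℝ → EuclideanSpace ℝ (Fin 3) → EuclideanSpace ℝ (Fin 3)) (p : ℝ → EuclideanSpace ℝ (Fin 3) → ℝ), Literature.Analysis.FluidPDE.IsMaximalSmoothSolution ν 0 u p T ∧ Literature.Analysis.FluidPDE.IsLerayHopfOn T ν 0 (u 0) u ∧ Literature.Analysis.FluidPDE.HasRapidSpatialDecay (u 0) ∧ (∀ t ∈ Set.Ico 0 T, Literature.Analysis.FluidPDE.IsAxisymmetric (u t)) ∧ ∃ C : ℝ, ∃ t₁ ∈ Set.Ico 0 T, ∀ t ∈ Set.Ico t₁ T, ∀ x : EuclideanSpace ℝ (Fin 3), ‖u t x‖ ^ 2 * (T - t) ≤ C * ν * (1 + Real.log (T / (T - t)))) ∧ (∀ ν : ℝ, 0 < ν → ∀ (u₀ : EuclideanSpace ℝ (Fin 3) → EuclideanSpace ℝ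 (Fin 3)), Literature.Analysis.FluidPDE.HasRapidSpatialDecay u₀ → ∀ (u v : ℝ → EuclideanSpace ℝ (Fin 3) → EuclideanSpace ℝ (Fin 3)) (p q : ℝ → EuclideanSpace ℝ (Fin 3) → ℝ) (T : ℝ), 0 < T → Literature.Analysis.FluidPDE.IsSmoothOnHalfSpace u → Literature.Analysis.FluidPDE.IsSmoothOnHalfSpace p → Literature.Analysis.FluidPDE.IsNavierStokesSolution ν 0 u₀ u p → Literature.Analysis.FluidPDE.HasBoundedEnergy u → Literature.Analysis.FluidPDE.IsClassicalNSSolutionOn (Set.Ico 0 T) ν 0 v q → Literature.Analysis.FluidPDE.IsLerayHopfOn T ν 0 u₀ v → v 0 = u₀ → ∀ t ∈ Set.Ico 0 T, u t = v t)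

/-- item stmt-NavierStokesRegularity-13881 · crux · rank 2 · open · by planner
why it might fail: print reaches only (ln ln 1/(T−t))^{1/48−} (arXiv:2201.01766 Thm 1.4; Palasek arXiv:2101.08586) and Harnack methods provably stall at ln ln; |ln|^{1/3} rests on the η-budget, which leaks if u_θ/r concentrates at r ≪ √(νRe_Γ(T−t)) where Γ does not control it.
sources: ChenTsaiZhang2022, Palasek2021, Pan2014, Seregin2021, arXiv:2201.01766, arXiv:2101.08586
[crux] STARVATION FLOOR (card K1, 'slow creep is impossible'): for every ν > 0 and every maximal
Leray–Hopf classical solution (u,p) on ℝ³×[0,T) from a rapidly decaying datum, axisymmetric on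
[0,T), there is c > 0 such that for every t₁ < T some t ∈ [t₁,T) and point x satisfy c·log(T/(T−t))
≤ (‖u(t,x)‖√((T−t)/ν))³ — i.e. limsup_{t↑T} c_u(t)/log(T/(T−t))^{1/3} > 0: the velocity excess of an
axisymmetric singularity cannot creep slower than the cube root of the logarithm (Type I, c_u
bounded, is the case print excludes; exponent 1/3 is the card's single-core starvation threshold,
target 1/2). [difficulty: XL] -/
@[route_item "route-NavierStokesRegularity-SwirlStarvation"]
def StarvationFloor : Prop :=
  ∀ (ν T : ℝ), 0 < ν → 0 < T → ∀ (u : ℝ → EuclideanSpace ℝ (Fin 3) → EuclideanSpace ℝ (Fin 3)) (p : ℝ → EuclideanSpace ℝ (Fin 3) → ℝ), Literature.Analysis.FluidPDE.IsMaximalSmoothSolution ν 0 u p T → Literature.Analysis.FluidPDE.IsLerayHopfOn T ν 0 (u 0) u → Literature.Analysis.FluidPDE.HasRapidSpatialDecay (u 0) → (∀ t ∈ Set.Ico 0 T, Literature.Analysis.FluidPDE.IsAxisymmetric (u t)) → ∃ c : ℝ, 0 < c ∧ ∀ t₁ ∈ Set.Ico 0 T, ∃ t ∈ Set.Ico t₁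 T, ∃ x : EuclideanSpace ℝ (Fin 3), c * Real.log (T / (T - t)) ≤ (‖u t x‖ * Real.sqrt ((T - t) / ν)) ^ 3

/-- item stmt-NavierStokesRegularity-13882 · crux · rank 3 · open · by planner
why it might fail: viscous fronts at exactly Burgers thickness have front-Reynolds number O(1) on their own scale — the regime where Burgers vortices/shear layers ARE stable for all circulation Reynolds numbers (GallayMaekawa2010) — and Hou's travelling Γ-front persists numerically (Hou2026 §4).
sources: GallayMaekawa2010, Hou2026, Hou2022PotentiallySingularNS, arXiv:2405.10916, KNSS2009
[crux] NO MARGINAL CREEP (card K2, instability branch, typed as a decider): in the same class, for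
every C and every t₁ < T some t ∈ [t₁,T) and x satisfy Cν(1 + log(T/(T−t))) < ‖u(t,x)‖²(T−t) — i.e.
limsup_{t↑T} c_u(t)²/log(T/(T−t)) = ∞: an axisymmetric singularity must creep strictly faster than
the one-loop / quasi-steady Γ-front rate p = 1/2 (the self-sharpening swirl front of Burgers
thickness ν/‖u‖∞ that the audit requires at p ≤ 1/2 cannot be sustained over infinitely many
turnover times at front Reynolds number c_u² → ∞). Equivalent to ¬MarginalCreepBlowup (support
CreepDichotomy) and implies StarvationFloor (support NoMarginalCreepFloor); proved, it closes this
route refuted and removes the κ > 0 template of card marginal-reynolds-creep-kappa from the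
axisymmetric class. [difficulty: XL] -/
@[route_item "route-NavierStokesRegularity-SwirlStarvation"]
def NoMarginalCreep : Prop :=
  ∀ (ν T : ℝ), 0 < ν → 0 < T → ∀ (u : ℝ → EuclideanSpace ℝ (Fin 3) → EuclideanSpace ℝ (Fin 3)) (p : ℝ → EuclideanSpace ℝ (Fin 3) → ℝ), Literature.Analysis.FluidPDE.IsMaximalSmoothSolution ν 0 u p T → Literature.Analysis.FluidPDE.IsLerayHopfOn T ν 0 (u 0) u → Literature.Analysis.FluidPDE.HasRapidSpatialDecay (u 0) → (∀ t ∈ Set.Ico 0 T, Literature.Analysis.FluidPDE.IsAxisymmetric (u t)) → ∀ C : ℝ, ∀ t₁ ∈ Set.Ico 0 T, ∃ t ∈ Set.Ico t₁ T, ∃ x : EuclideanSpace ℝ (Fin 3), C * ν * (1 + Real.log (T / (T - t))) < ‖u t x‖ ^ 2 * (T - t)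

/-- item stmt-NavierStokesRegularity-13883 · crux · rank 4 · open · by planner
why it might fail: axisymmetric NS may be regular (AxisymmetricSwirlRegularity); no constant-ν construction exists (Hou2026 needs n = 3.188 or a solution-dependent viscosity), and a √log-corrected profile has no exact similarity ODE to certify against (LeraySelfSimilarBlowupExclusion forces the correction).
sources: Hou2022PotentiallySingularNS, Hou2026, arXiv:2405.10916, ChenHou2022, KNSS2009, NecasRuzickaSverak1996
[crux] MARGINAL-CREEP BLOW-UP (the constructive spine; card negative branch 'K2 persistence ∧ κ > 0
template'): for some ν > 0 there are T ∈ (0,∞) and a classical solution (u,p) of unforced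
Navier–Stokes on ℝ³×[0,T), Leray–Hopf from its rapidly decaying datum, axisymmetric at every t ∈
[0,T), admitting no classical extension past T, whose velocity excess creeps at most marginally: for
some C and t₁, ‖u(t,x)‖²(T−t) ≤ Cν(1 + log(T/(T−t))) for all t ∈ [t₁,T), x. Strictly stronger than
the shared AxisymBlowup (stmt-NavierStokesRegularity-0727: drop the rate); by
AxisymmetricTypeIExclusion (in tree, proved) every witness has c_u unbounded, so the class is the
first super-Type-I shell c_u ≍ √log — the audited reading of Hou's run (q_ω = 1 ⇒ p ≥ 1/2 by (S); Z
~ √(T−t); Burgers-thin Γ-front), to be reached by a log-corrected dynamic-rescaling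
construction/certificate. [difficulty: open-problem] -/
@[route_item "route-NavierStokesRegularity-SwirlStarvation", crux]
def MarginalCreepBlowup : Prop :=
  ∃ ν : ℝ, 0 < ν ∧ ∃ T : ℝ, 0 < T ∧ ∃ (u : ℝ → EuclideanSpace ℝ (Fin 3) → EuclideanSpace ℝ (Fin 3)) (p : ℝ → EuclideanSpace ℝ (Fin 3) → ℝ), Literature.Analysis.FluidPDE.IsMaximalSmoothSolution ν 0 u p T ∧ Literature.Analysis.FluidPDE.IsLerayHopfOn T ν 0 (u 0) u ∧ Literature.Analysis.FluidPDE.HasRapidSpatialDecay (u 0) ∧ (∀ t ∈ Set.Ico 0 T, Literature.Analysis.FluidPDE.IsAxisymmetric (u t)) ∧ ∃ C : ℝ, ∃ t₁ ∈ Set.Ico 0 T, ∀ t ∈ Set.Ico t₁ T, ∀ x : EuclideanSpace ℝ (Fin 3), ‖u t x‖ ^ 2 * (T - t) ≤ C * ν * (1 + Real.log (T / (T - t)))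

/-- item stmt-NavierStokesRegularity-0153 · support · rank 9 · closed · proved by Summit.NavierStokesRegularity.NavierStokesRegularity.Theorems.adiabaticEddy_clayUniqueness_proof @ bd26efe366a2 (prover) · by planner
sources: Fefferman2000, LemarieRieusset2016, arXiv:1108.1165
Fefferman's class (A) = jointly C^∞ on ℝ³×[0,∞) + sup_t ∫|u|² < ∞; no energy inequality, no decay of
∇u, no integrability in LPS scales is assumed. Claim: such (u,p) coincides on [0,T) with any
Leray–Hopf classical solution v from the same rapidly decaying datum. Expected route: smoothness +
bounded energy ⇒ u is a distributional solution with locally finite dissipation?? (NOT automatic: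
∫∫|∇u|² may be infinite) — this is exactly the delicate point; alternatives: Liouville-type control
of the pressure (p harmonic part must be affine ⇒ excluded by bounded energy), then local energy
inequality, then weak–strong uniqueness (Prodi 1959, Serrin 1963) against v which is in every LPS
class on compacts of [0,T). [sources: Prodi1959, Serrin1963, Fefferman2000, LemarieRieusset2002,
RobinsonRodrigoSadowski2016] -/
@[route_item "route-NavierStokesRegularity-SwirlStarvation", crux]
def BlowupClayUniqueness : Prop :=
  ∀ ν : ℝ, 0 < ν → ∀ (u₀ : EuclideanSpace ℝ (Fin 3) → EuclideanSpace ℝ (Fin 3)), Literature.Analysis.FluidPDE.HasRapidSpatialDecay u₀ → ∀ (u v : ℝ → EuclideanSpace ℝ (Fin 3) → EuclideanSpace ℝ (Fin 3)) (p q : ℝ → EuclideanSpace ℝ (Fin 3) → ℝ) (T : ℝ), 0 < T → Literature.Analysis.FluidPDE.IsSmoothOnHalfSpace u → Literature.Analysis.FluidPDE.IsSmoothOnHalfSpace p → Literature.Analysis.FluidPDE.IsNavierStokesSolution ν 0 u₀ u p → Literature.Analysis.FluidPDE.HasBoundedEnergy u → Literature.Analysis.FluidPDE.IsClassicalNSSolutionOn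 (Set.Ico 0 T) ν 0 v q → Literature.Analysis.FluidPDE.IsLerayHopfOn T ν 0 u₀ v → v 0 = u₀ → ∀ t ∈ Set.Ico 0 T, u t = v t

/-- `BlowupClayUniqueness` holds: proved by `Summit.NavierStokesRegularity.NavierStokesRegularity.Theorems.adiabaticEddy_clayUniqueness_proof` @ bd26efe366a2. -/
theorem BlowupClayUniqueness_holds : BlowupClayUniqueness := _root_.Summit.NavierStokesRegularity.NavierStokesRegularity.Theorems.adiabaticEddy_clayUniqueness_proof

/-- item stmt-NavierStokesRegularity-13884 · support · rank 9 · closed · proved by Summit.NavierStokesRegularity.NavierStokesRegularity.Theorems.swirlStarvation_creepDichotomy_proof (prover) · by planner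
sources: KNSS2009
[support] NoMarginalCreep ↔ ¬MarginalCreepBlowup — push the negation through ∃/∀ (PROVED in the
planner's Sketch.lean, creepDichotomy_holds), so that a proof of either crux closes the other as
refuted in one line. [difficulty: provable-now] -/
@[route_item "route-NavierStokesRegularity-SwirlStarvation"]
def CreepDichotomy : Prop :=
  NoMarginalCreep ↔ ¬ MarginalCreepBlowup

-- `CreepDichotomy` holds: proved by `Summit.NavierStokesRegularity.NavierStokesRegularity.Theorems.swirlStarvation_creepDichotomy_proof` (its module imports this route file, so no `_holds` link can be stated here).

/-- item stmt-NavierStokesRegularity-13885 · support · rank 9 · closed · proved by Summit.NavierStokesRegularity.NavierStokesRegularity.Theorems.swirlStarvation_starvationFailureBlowup_proof (prover) · by planner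
sources: KNSS2009
[support] ¬StarvationFloor → MarginalCreepBlowup — the floor crux is informative both ways: its
failure exhibits an axisymmetric blow-up with c_u³ < log(T/(T−t)) eventually, hence c_u² ≤ 1 + log
(y ≥ 0, y³ < L ⇒ y² ≤ 1 + L), i.e. the spine with C = 1 (PROVED in Sketch.lean,
starvationFailureBlowup_holds). [difficulty: provable-now] -/
@[route_item "route-NavierStokesRegularity-SwirlStarvation"]
def StarvationFailureBlowup : Prop :=
  ¬ StarvationFloor → MarginalCreepBlowup

-- `StarvationFailureBlowup` holds: proved by `Summit.NavierStokesRegularity.NavierStokesRegularity.Theorems.swirlStarvation_starvationFailureBlowup_proof` (its module imports this route file, so no `_holds` link can be stated here).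

/-- item stmt-NavierStokesRegularity-13886 · support · rank 9 · closed · proved by Summit.NavierStokesRegularity.NavierStokesRegularity.Theorems.swirlStarvation_noMarginalCreepFloor_proof (prover) · by planner
sources: KNSS2009
[support] NoMarginalCreep → StarvationFloor — the nesting of the two regularity-side cruxes (c_u² >
1 + log ⇒ c_u > 1 ⇒ c_u³ > log; take c = 1), so that the creep window [1/3, 1/2] is exactly
StarvationFloor ∧ ¬NoMarginalCreep (PROVED in Sketch.lean). [difficulty: provable-now] -/
@[route_item "route-NavierStokesRegularity-SwirlStarvation"]
def NoMarginalCreepFloor : Prop :=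
  NoMarginalCreep → StarvationFloor

-- `NoMarginalCreepFloor` holds: proved by `Summit.NavierStokesRegularity.NavierStokesRegularity.Theorems.swirlStarvation_noMarginalCreepFloor_proof` (its module imports this route file, so no `_holds` link can be stated here).

/-- item stmt-NavierStokesRegularity-13887 · support · rank 9 · open · by planner
sources: ChaeLee2002, ChenFangZhang2017, LeiZhang2017, HouLi2008, KNSS2009
[support] ETA-BOUNDED CONTINUATION (card P1 criterion; the lower half of the foreseen split of
StarvationFloor): a Leray–Hopf classical solution on ℝ³×[0,T) from a rapidly decaying datum,
axisymmetric on [0,T), with |r·ω_θ| = |swirl(curl u)| ≤ K r² on [0,T)×ℝ³ (i.e. η = ω_θ/r =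
angVortQuot bounded) extends classically past T. Route: η ∈ L^∞ (+ energy) ⇒ u_r/r = ∂_z Δ₅⁻¹ η
bounded (in-tree elliptic identity IsAxisymmetric.laplacian_radVelQuot_add; LeiZhang2017 Lemma 2.1)
⇒ u_θ/r obeys a linear drift–diffusion equation with bounded potential −2u_r/r, so sup|u_θ/r| ≤
sup|u₀,θ/r|·exp(2∫‖u_r/r‖∞) ⇒ u_θ bounded near the axis (and |u_θ| ≤ ‖Γ₀‖∞/r away) ⇒ continuation by
the u_θ ∈ L^∞_tL^∞_x criterion (ChaeLee2002; Neustupa–Pokorný; ChenFangZhang2017) and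
(∞,∞)-Prodi–Serrin. [difficulty: L] -/
@[route_item "route-NavierStokesRegularity-SwirlStarvation"]
def EtaBoundedRegular : Prop :=
  ∀ (ν T : ℝ), 0 < ν → 0 < T → ∀ (u : ℝ → EuclideanSpace ℝ (Fin 3) → EuclideanSpace ℝ (Fin 3)) (p : ℝ → EuclideanSpace ℝ (Fin 3) → ℝ), Literature.Analysis.FluidPDE.IsClassicalNSSolutionOn (Set.Ico 0 T) ν 0 u p → Literature.Analysis.FluidPDE.IsLerayHopfOn T ν 0 (u 0) u → Literature.Analysis.FluidPDE.HasRapidSpatialDecay (u 0) → (∀ t ∈ Set.Ico 0 T, Literature.Analysis.FluidPDE.IsAxisymmetric (u t)) → (∃ K : ℝ, ∀ t ∈ Set.Ico 0 T, ∀ x : EuclideanSpace ℝ (Fin 3), |Literature.Analysis.FluidPDE.swirl (Literature.Analysis.FluidPDE.curl (u t)) x| ≤ K * Literature.Analysis.FluidPDE.cylRadius x ^ 2) → Literature.Analysis.FluidPDE.HasSmoothExtensionPast ν 0 u T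

/-- item stmt-NavierStokesRegularity-13888 · support · rank 9 · closed · proved by Summit.NavierStokesRegularity.NavierStokesRegularity.Theorems.swirlStarvation_smoothingExcess_proof (prover) · by planner
sources: GigaInuiMatsui1999, KNSS2009, LemarieRieusset2016
[support] SMOOTHING EXCESS BOUND (card fact (S), c_ω ≤ C_S c_u²; general data, no symmetry): there
is an absolute C_S such that for every Leray–Hopf classical solution on [0,T) from a rapidly
decaying datum, every M and times 0 ≤ t₀ < t < T with ν ≤ M²(t − t₀) and ‖u‖ ≤ M on [t₀,t]×ℝ³, one
has ν‖curl u(t,x)‖ ≤ C_S M² for all x — the k = 1 case of the L^∞ mild smoothing estimate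
(GigaInuiMatsui1999; KNSS2009 Prop 4.1/(4.6), in-tree KNSS2009_prop41_mild) applied from t − ν/M²,
plus identification of the classical Leray–Hopf solution with the bounded mild one. [difficulty: M] -/
@[route_item "route-NavierStokesRegularity-SwirlStarvation"]
def SmoothingExcess : Prop :=
  ∃ C_S : ℝ, 0 < C_S ∧ ∀ (ν T : ℝ), 0 < ν → 0 < T → ∀ (u : ℝ → EuclideanSpace ℝ (Fin 3) → EuclideanSpace ℝ (Fin 3)) (p : ℝ → EuclideanSpace ℝ (Fin 3) → ℝ), Literature.Analysis.FluidPDE.IsClassicalNSSolutionOn (Set.Ico 0 T) ν 0 u p → Literature.Analysis.FluidPDE.IsLerayHopfOn T ν 0 (u 0) u → Literature.Analysis.FluidPDE.HasRapidSpatialDecay (u 0) → ∀ (M t₀ t : ℝ), 0 ≤ t₀ → t₀ < t → t < T → ν ≤ M ^ 2 * (t - t₀) → (∀ s ∈ Set.Icc t₀ t, ∀ y : EuclideanSpace ℝ (Fin 3), ‖u s y‖ ≤ M) → ∀ x : EuclideanSpace ℝ (Fin 3), ν * ‖Literature.Analysis.FluidPDE.curl (u t) x‖ ≤ C_S * M ^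 2

-- `SmoothingExcess` holds: proved by `Summit.NavierStokesRegularity.NavierStokesRegularity.Theorems.swirlStarvation_smoothingExcess_proof` (its module imports this route file, so no `_holds` link can be stated here).

/-- item stmt-NavierStokesRegularity-13889 · assembly · rank 1 · closed · proved by Summit.NavierStokesRegularity.NavierStokesRegularity.Theorems.swirlStarvation_assembly_proof (prover) · by planner
sources: Fefferman2000, BealeKatoMajda1984
[assembly] MarginalCreepBlowup → BlowupClayUniqueness → ¬NavierStokesRegularity. -/
@[route_item "route-NavierStokesRegularity-SwirlStarvation"]
def Assembly : Prop :=
  MarginalCreepBlowup → BlowupClayUniqueness → ¬ NavierStokesRegularity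

-- `Assembly` holds: proved by `Summit.NavierStokesRegularity.NavierStokesRegularity.Theorems.swirlStarvation_assembly_proof` (its module imports this route file, so no `_holds` link can be stated here).

/-! D-0027 §2.1 — DECIDING THEOREM (planner-authored via `route open/edit --closes-file`; by planner-rrepair-NavierStokesRegularity-SwirlSt-05594d0a-0 2026-08-15T20:19:24Z):
its hypotheses are this route's items and its conclusion the sub-problem Statement (glue_lint), and it elaborates with this file. -/

@[closes "route-NavierStokesRegularity-SwirlStarvation"] theorem closes (hB : MarginalCreepBlowup) (hU : BlowupClayUniqueness) : ¬ _root_.NavierStokesRegularity := by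
  intro hReg
  obtain ⟨ν, hν, T, hT, u, p, ⟨hcl, hmax⟩, hLH, hdec, -, -⟩ := hB
  have h0 : (0 : ℝ) ∈ Set.Ico 0 T := ⟨le_rfl, hT⟩
  obtain ⟨u', p', hu', hp', hns, hbe⟩ :=
    hReg ν hν (u 0) (hcl.contDiff_velocity h0) (hcl.divFree 0 h0) hdec
  have heq : ∀ t ∈ Set.Ico 0 T, u' t = u t :=
    hU ν hν (u 0) hdec u' u p' p T hT hu' hp' hns hbe hcl hLH rfl
  have hcl' : Literature.Analysis.FluidPDE.IsClassicalNSSolutionOn (Set.Ici 0) ν 0 u' p' :=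
    ⟨hu', hp', fun t ht x => hns.momentum t ht x, fun t ht => hns.divFree t ht⟩
  refine hmax ⟨T + 1, by linarith, u', p', ?_, heq⟩
  exact hcl'.mono (fun t ht => ht.1) (uniqueDiffOn_Ico 0 (T + 1))

end Summit.NavierStokesRegularity.NavierStokesRegularity.Theses.SwirlStarvation
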